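import Summits.Parity.GeneralizedHardyLittlewood.Theorems.LeeYangFibresCellParityLawSavingDefs
import HarnessLib

/-!
# Route `LeeYangFibres`, crux `CellParityLawSaving` (stmt-Parity-18104), line `superpoly-band-same-atom`:
# vocabulary of the ENGINE along the schedule (skeleton v2)

Route-posited STATEMENTS (D-0016 `<Route><Crux>…Defs` file; companion of `LeeYangFibresCellParityLawSavingDefs`).
NOTHING IS ASSERTED: every `def … : Prop` is the type of a registered stub of skeleton v2
(`Cruxes/CellParityLawSaving/Lines/SketchIdeator3.lean`, lead `prover-line-stmt-Parity-18104-0`) or of a hypothesis of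
one; the three theorems (`composeSav2`, `engineSav2_of_pieces`, `engineSav2_of_engineSav`) are pure logic.

## Why (lead, cycle 1, 2026-08-17)

After skeleton v1 the crux is closed modulo the atom `stub_atom`, the kernel `stub_kernel` and the ENGINE
`stub_engineSav : EngineSav` (kernel → atom → Bombieri's one-parameter section law along the schedule): the three
provable stubs `stub_densityAlong` (p159270), `stub_walshStepSav` (p159624), `stub_baseSavInlined` (p161685) and the
reduction `stub_reductionSav` have landed. v2 RESHAPES the engine, which is the sister crux's finite-level engine
(`Theorems/LeeYangFibresCellParityLaw{KernelDefs,GeThreeHyp,GeThreeReduce,MainTerm,MertensTwo,GeThreeAssembly,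
PrConversion}`) re-run at `u = U(N) = slowDegree N` with `(log N)^δ` budgets, into five registered provable-glue
stubs and one bookkeeping change:

* the engine may use the law for the `t`-form SUB-systems (`LawSavAt t`, the induction hypothesis of `composeSav`):
  along the schedule the fibre mass `F⁽ⁱ⁾_{j'}` (an `N^{1/U(N)}`-rough `t`-tuple count, `≍ N U^t/log^t N`) is priced by
  that law to `N (log N)^{o(1)}/log^t N`, whereas the sister's fixed-`u` input `uniformRoughTupleBound` hides its
  `u`-dependence — hence `EngineSav2` / `ComposeSav2` (the induction feeds the hypothesis; pure logic, proved here);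
* `HypAlong` (kernel hypotheses for the localised section sequence along the schedule, port of `GeThreeHyp`),
  `ReduceAlong` (the kernel `SuperPolyRoughCellLaw a` applied at deficit `η = 2(log log N)^{-B₂}` with `a B₂ ≥ 2`, port
  of `GeThreeReduce`), `MainTermAlong` (two-sided Mertens at `N^{1/U(N)}` + Alladi along the schedule, port of
  `MertensTwo`/`MainTerm` through the landed `anatomyAlong_bridge`), `PrepAlong` (degenerate cases and the fibre-mass
  bound along the schedule), `AssemblyAlong` (localisation / small mass / raw law / conversion, port of
  `GeThreeAssembly` + `lawOfPrLaw`, concluding `SectionLawSavAt` directly through `sectionH = 𝔖/𝔖₋ᵢ`).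

Along the schedule `u = U(N) ≥ 4` always, so the sister's `u = 2` rung (`PrLawTwo*`) has no analogue here; and every
`e^{O(U log U)}` / `(log log N)^{O(1)}` quantity is `(log N)^{o(1)}` (`4U² ≤ log log N ≤ (2U+2)²`,
`quantClip_schedule`), which is why all auxiliary bounds below carry an arbitrary `(log N)^ε`.

The sister's `u`-free landed inputs are consumed by name: `SectionSeqBFacts` (p116093), `SectionSeqBCells` (p116310),
`SectionDimension`, `SectionDimensionLow` (p116440), `SectionMertensLowerHead` (p116383), `SingularRatioBound`; and this
line's `DensityBoundsAlong` (p159270). Parameters as in the sister (`xOf L N = 2LN`, `zOf N u = N^{1/u}` at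
`u := slowDegree N`, `etaOf N B₂ = 2/(log log N)^{B₂}`, `lamOf N t = (log N)^{t+2}`, `wOf N = (log N)²`,
`rOf N A = N/(log N)^A`).

References: E. Bombieri, Rend. Accad. Naz. XL (5) 1/2 (1975/76) [BombieriAsymptoticSieve1976]; RIMS 294 (1977) p. 5
[BombieriRIMS1977]; Friedlander–Iwaniec, Ann. Sc. Norm. Pisa (1978) §4 [FriedlanderIwaniecPisa1978]; K. Ford, Trans.
AMS 357 (2005) [Ford2004]; K. Alladi, Quart. J. Math. 33 (1982) [Alladi1982].
-/

noncomputable section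

open scoped BigOperators Classical
open Finset Filter Literature.NumberTheory.Sieve
open Summit.Parity.GeneralizedHardyLittlewood.Cruxes.CellParityLaw.SectionAnnihilator
open Summit.Parity.GeneralizedHardyLittlewood.Cruxes.AbsoluteUpgrade.DipMarginRateExchange (slowDegree)

namespace Summit.Parity.GeneralizedHardyLittlewood.Cruxes.CellParityLawSaving.SuperPolyBand

/-! ## The engine with the induction hypothesis, and the composition (pure logic) -/

/-- **The engine along the schedule, fed with the sub-system law** (`EngineSav2`; what skeleton v2 composes): the
kernel for some exponent `a > 0` and the atom along the schedule give, for every `t ≥ 1`, the implication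
`LawSavAt t → SectionLawSavAt t` — the law for `t`-form systems (available in the induction of `composeSav2`) may be
used to price the fibre masses of the `(t+1)`-form sections. Weaker than `EngineSav` (`engineSav2_of_engineSav`). -/
def EngineSav2 : Prop :=
  (∃ a : ℝ, 0 < a ∧ SuperPolyRoughCellLaw a) → (∀ t : ℕ, 1 ≤ t → SectionLevelAlong t) →
    ∀ t : ℕ, 1 ≤ t → LawSavAt t → SectionLawSavAt t

/-- **The composition step with the fed engine** (`ComposeSav2`): as `ComposeSav`, but the section law at `t` is
only asked for under the law at `t`. Pure logic (induction on `t`); proved below. -/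
def ComposeSav2 : Prop :=
  DensityBoundsAlong → SingularRatioBound → WalshStepSav → LawSavAt 1 →
    (∀ t : ℕ, 1 ≤ t → LawSavAt t → SectionLawSavAt t) → ∀ t : ℕ, 1 ≤ t → LawSavAt t

/-- **`composeSav2`** (pure logic): induction on `t`; at the step the induction hypothesis feeds the engine. -/
theorem composeSav2 : ComposeSav2 := by
  intro hDens hSing hStep hBase hSec t ht
  induction t, ht using Nat.le_induction with
  | base => exact hBase
  | succ t ht ih => exact hStep hDens hSing t ht (hSec t ht ih) ih

/-- The v1 engine statement implies the v2 one (ignore the extra hypothesis). -/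
theorem engineSav2_of_engineSav (h : EngineSav) : EngineSav2 :=
  fun hK hA t ht _ => h hK hA t ht

/-! ## Statement types of the engine along the schedule -/

/-- **The kernel's hypotheses for the localised section sequence along the schedule** (`KernelReadySavAt t`;
conclusion of `HypAlong`): the sister's `KernelReadyAt t` VERBATIM with `u := U(N) = slowDegree N` (frozen cells
`j' ∈ [1,U(N)]^t`), plus the one extra range condition of the kernel `SuperPolyRoughCellLaw`,
`U(N) ≤ √(log log x)` (`x = 2LN`). For `N ≥ N₀(t, L, A, B₂)` the sequence `𝒜 = secSeqB Ψ K N U i j'` with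
`x = xOf L N`, `z = zOf N U`, `η = etaOf N B₂`, `Λ = lamOf N t`, `w₀ = wOf N`, `R = rOf N A`, `A₁ = t + 2` and ONE
`L' = L'(t, L)` satisfies every hypothesis of the kernel verbatim, and its cells / size / density product are the
crux's `C_{(m,j')}` (`m ≥ 1`), `F⁽ⁱ⁾_{j'}` and `V(N^{1/U})`. -/
def KernelReadySavAt (t : ℕ) : Prop :=
  ∀ (L A B₂ : ℕ), 1 ≤ B₂ → ∃ L' : ℝ, ∃ N₀ : ℕ, ∀ N : ℕ, N₀ ≤ N →
    ∀ Ψ : Fin (t + 1) → AffLinForm 1, IsNondegenerateSystem Ψ → affLinSize Ψ N ≤ L →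
    ∀ K : Set (Fin 1 → ℝ), Convex ℝ K → K ⊆ realBox 1 N →
    ∀ i : Fin (t + 1), ∀ j' : Fin t → ℕ, (∀ k, 1 ≤ j' k ∧ j' k ≤ slowDegree N) →
      (∀ p : ℕ, p.Prime → sectionDensity Ψ i p < 1) →
      K ⊆ {v | xOf L N / lamOf N t < (Ψ i).realEval v} →
      (N : ℝ) / Real.log N ^ (t + 2) ≤ sectionMass Ψ K N (slowDegree N) i j' 1 →
      ((slowDegree N : ℝ) ≤ Real.sqrt (Real.log (Real.log (xOf L N))) ∧
        xOf L N ^ (1 / ((slowDegree N : ℝ) + 1)) ≤ zOf N (slowDegree N) ∧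
        zOf N (slowDegree N) ≤ xOf L N ^ (1 / (slowDegree N : ℝ)) ∧
        Real.log (xOf L N) ^ (-(1 / 2 : ℝ)) ≤ etaOf N B₂ ∧ etaOf N B₂ ≤ 1 / (4 * (slowDegree N : ℝ)) ∧
        1 ≤ lamOf N t ∧ lamOf N t ≤ xOf L N ^ etaOf N B₂ ∧ 2 ≤ wOf N ∧ wOf N ≤ xOf L N ^ etaOf N B₂) ∧
      (∀ q : ℕ, (secSeqB Ψ K N (slowDegree N) i j').a q ≤ 1) ∧
      (∀ q : ℕ, xOf L N < (q : ℝ) → (secSeqB Ψ K N (slowDegree N) i j').a q = 0) ∧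
      (∀ q : ℕ, (q : ℝ) ≤ xOf L N / lamOf N t → (secSeqB Ψ K N (slowDegree N) i j').a q = 0) ∧
      (∀ y : ℝ, (secSeqB Ψ K N (slowDegree N) i j').size y = (secSeqB Ψ K N (slowDegree N) i j').congrSum 1 y) ∧
      xOf L N ^ (1 - 1 / (4 * (slowDegree N : ℝ))) ≤ (secSeqB Ψ K N (slowDegree N) i j').size (xOf L N) ∧
      (∀ p : ℕ, p.Prime → (secSeqB Ψ K N (slowDegree N) i j').density p ≤ ((t : ℝ) + 2) / p) ∧
      HasIwaniecDimension (secSeqB Ψ K N (slowDegree N) i j').density 1 L' ∧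
      (∀ w z' : ℝ, wOf N ≤ w → w ≤ z' → z' ≤ xOf L N →
          Real.log z' / Real.log w * (1 - L' / Real.log w) ≤
            ∏ p ∈ (Nat.primesBelow ⌈z'⌉₊).filter (fun p : ℕ => w ≤ (p : ℝ)),
              (1 - (secSeqB Ψ K N (slowDegree N) i j').density p)⁻¹) ∧
      (∀ y : ℝ, y ≤ xOf L N →
          ∑ d ∈ (Finset.Icc 1 ⌊xOf L N ^ (1 - etaOf N B₂)⌋₊).filter Squarefree,
            |(secSeqB Ψ K N (slowDegree N) i j').remainder d y| ≤ rOf N A) ∧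
      (∀ m : ℕ, 1 ≤ m →
          roughCellSum (secSeqB Ψ K N (slowDegree N) i j') (xOf L N) (zOf N (slowDegree N)) m =
            cell Ψ K N (slowDegree N) (i.insertNth m j')) ∧
      (secSeqB Ψ K N (slowDegree N) i j').size (xOf L N) = sectionMass Ψ K N (slowDegree N) i j' 1 ∧
      (secSeqB Ψ K N (slowDegree N) i j').densityProduct (primesProdBelow (zOf N (slowDegree N))) =
        ∏ p ∈ Nat.primesBelow ⌈zOf N (slowDegree N)⌉₊, (1 - sectionDensity Ψ i p)

/-- **The raw section law along the schedule** (`RawSectionLawSavAt t`; conclusion of `ReduceAlong`): for a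
LOCALISED body `K ⊆ {ψ_i > x/Λ}` of LARGE fibre mass `F ≥ N/log^{t+2} N`, in the case of no degenerate prime,
for SOME `δ = δ(t, L) > 0` (any `δ < min(κ, 1)/2` of the kernel's `κ`) and `N ≥ N₀`: ONE `δ' ∈ [0,2]` with
`|C_{(m,j')} − (1 + (δ'-1)(-1)^m)(I_m(u')/u') e^γ V(N^{1/U}) F| ≤ V(N^{1/U}) F/(log N)^δ + N/log^{t+2} N` for
every `m ≥ 1` (`u' = log x/log N^{1/U}`, `V = ∏_{p < N^{1/U}} (1 - g(p))`, `I_m = roughCellDensity m`). The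
kernel's four error terms along the schedule: `C e^{CU²} e^{-cη^{-a}} ≤ (log N)^{C/4} (log N)^{-c (log log N)/2^a}`
(`4U² ≤ log log N`, `η^{-a} ≥ (log log N)^{aB₂}/2^a ≥ (log log N)²/2^a`), `C(log z)^{-κ} = C(U/log N)^κ ≤ (log N)^{-κ/2}`,
`C log(2Λ)/log z ≤ C(t+3)√(log log N) log log N/log N`, `C(log x)^{A₂} R ≤ N/log^{t+2} N` for `A = A₂ + t + 3`. -/
def RawSectionLawSavAt (t : ℕ) : Prop :=
  ∀ L : ℕ, ∃ δ : ℝ, 0 < δ ∧ ∃ N₀ : ℕ, ∀ N : ℕ, N₀ ≤ N →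
    ∀ Ψ : Fin (t + 1) → AffLinForm 1, IsNondegenerateSystem Ψ → affLinSize Ψ N ≤ L →
    ∀ K : Set (Fin 1 → ℝ), Convex ℝ K → K ⊆ realBox 1 N →
    ∀ i : Fin (t + 1), ∀ j' : Fin t → ℕ, (∀ k, 1 ≤ j' k ∧ j' k ≤ slowDegree N) →
      (∀ p : ℕ, p.Prime → sectionDensity Ψ i p < 1) →
      K ⊆ {v | xOf L N / lamOf N t < (Ψ i).realEval v} →
      (N : ℝ) / Real.log N ^ (t + 2) ≤ sectionMass Ψ K N (slowDegree N) i j' 1 →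
      ∃ δ' : ℝ, 0 ≤ δ' ∧ δ' ≤ 2 ∧ ∀ m : ℕ, 1 ≤ m →
        |(cell Ψ K N (slowDegree N) (i.insertNth m j') : ℝ) -
            (1 + (δ' - 1) * (-1 : ℝ) ^ m) *
              (roughCellDensity m (Real.log (xOf L N) / Real.log (zOf N (slowDegree N))) /
                (Real.log (xOf L N) / Real.log (zOf N (slowDegree N)))) *
              (Real.exp Real.eulerMascheroniConstant *
                ∏ p ∈ Nat.primesBelow ⌈zOf N (slowDegree N)⌉₊, (1 - sectionDensity Ψ i p)) *
              (sectionMass Ψ K N (slowDegree N) i j' 1 : ℝ)|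
          ≤ (∏ p ∈ Nat.primesBelow ⌈zOf N (slowDegree N)⌉₊, (1 - sectionDensity Ψ i p)) *
                (sectionMass Ψ K N (slowDegree N) i j' 1 : ℝ) / Real.log N ^ δ +
              (N : ℝ) / Real.log N ^ (t + 2)

/-- **Main-term conversion along the schedule** (`MainTermConversionAlong`; conclusion of `MainTermAlong`): in the
non-degenerate case, for every `ε > 0` and `N ≥ N₀(t, L, ε)`, (a) `e^γ V(N^{1/U}) ≤ H_{Ψ,i} (log N)^ε/log N`
(two-sided Mertens at `z = N^{1/U}`: `e^γ V ≈ U H/log N`, `U ≤ √(log log N)`), and (b) for every `δ' ∈ [0,2]`,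
`m ≥ 1` and mass `F' ≥ 0` the kernel's main term `(1 + (δ'-1)(-1)^m)(I_m(u')/u') e^γ V F'`
(`u' = log(2LN)/log N^{1/U}`) differs from the crux's `(1 + (δ'-1)(-1)^m) a_m H_{Ψ,i} F'` by at most
`H_{Ψ,i} F' (log N)^ε/log² N` (Alladi along the schedule `|a_m − I_m(U)/log N| ≤ 3A^{2U}U²/log² N`,
`anatomyAlong_bridge`; `|I_m(u') − I_m(U)| ≤ u' − U ≤ U log(2L)/log N`; `I_m ≤ U`; all `(log N)^{o(1)}`). -/
def MainTermConversionAlong : Prop :=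
  ∀ (t L : ℕ) (ε : ℝ), 0 < ε → ∃ N₀ : ℕ, ∀ N : ℕ, N₀ ≤ N →
    ∀ Ψ : Fin (t + 1) → AffLinForm 1, IsNondegenerateSystem Ψ → affLinSize Ψ N ≤ L →
    ∀ i : Fin (t + 1), (∀ p : ℕ, p.Prime → sectionDensity Ψ i p < 1) →
      singularProduct (Fin.removeNth i Ψ) ≠ 0 →
      Real.exp Real.eulerMascheroniConstant *
            ∏ p ∈ Nat.primesBelow ⌈zOf N (slowDegree N)⌉₊, (1 - sectionDensity Ψ i p) ≤
          sectionH Ψ i * Real.log N ^ ε / Real.log N ∧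
      ∀ δ' : ℝ, 0 ≤ δ' → δ' ≤ 2 → ∀ m : ℕ, 1 ≤ m → ∀ F' : ℝ, 0 ≤ F' →
        |(1 + (δ' - 1) * (-1 : ℝ) ^ m) *
              (roughCellDensity m (Real.log (xOf L N) / Real.log (zOf N (slowDegree N))) /
                (Real.log (xOf L N) / Real.log (zOf N (slowDegree N)))) *
              (Real.exp Real.eulerMascheroniConstant *
                ∏ p ∈ Nat.primesBelow ⌈zOf N (slowDegree N)⌉₊, (1 - sectionDensity Ψ i p)) * F' -
            (1 + (δ' - 1) * (-1 : ℝ) ^ m) * modelDensity N (slowDegree N) m * sectionH Ψ i * F'|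
          ≤ sectionH Ψ i * F' * Real.log N ^ ε / Real.log N ^ 2

/-- **Preparations along the schedule** (`PrepAlong`; type of the registered stub `stub_prepAlong`):
(a) DEGENERATE CASES — for `N ≥ N₀(t, L)`, if the section density has a degenerate prime (`g(p) = 1`: then
`ν_p(Ψ) = p` with `p ≤ max(t+1, L) < N^{1/U(N)}`) or the frozen sub-system is locally obstructed (`𝔖(Ψ₋ᵢ) = 0`),
then every joint cell at the coordinate `i` is empty and the model factor `H_{Ψ,i} · F⁽ⁱ⁾_{j'}` vanishes (the
sister's `PrLawTwoPrep` (a) at `u := U(N)`; `N^{1/U(N)} → ∞` by `quantClip_schedule`);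
(b) EULER RATIO — for `N ≥ N₀(t, L)`: `𝔖(Ψ₋ᵢ) ≠ 0 → H_{Ψ,i} = 𝔖(Ψ)/𝔖(Ψ₋ᵢ)` (the landed `EulerRatioAux.sectionH_eq`,
`u`-free) and `𝔖(Ψ₋ᵢ) = 0 →` every fibre mass at roughness `U(N)` vanishes;
(c) FIBRE MASS — given the anatomy bounds along the schedule and the law for `t`-form systems, for every `ε > 0`
and `N ≥ N₀(t, L, ε)` every fibre mass is `≤ N (log N)^ε/log^t N` (the fibre mass IS the `t`-form cell of `Ψ₋ᵢ`
over the convex half-body `K ∩ {ψ_i > 0}`, `WalshStepAux.sectionMass_one_eq_cell`; `|W_θ| ≤ 2^t`,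
`β_∞ ≤ 2N + 1`, `𝔖(Ψ₋ᵢ) ≤ C (log log N)^{t-1}` by `stub_singularProduct_le_loglog_pow`, `∏ a ≤ ((log N)^ε/log N)^t`). -/
def PrepAlong : Prop :=
  (∀ (t L : ℕ), ∃ N₀ : ℕ, ∀ N : ℕ, N₀ ≤ N →
      ∀ Ψ : Fin (t + 1) → AffLinForm 1, IsNondegenerateSystem Ψ → affLinSize Ψ N ≤ L →
      ∀ (K : Set (Fin 1 → ℝ)) (i : Fin (t + 1)) (j' : Fin t → ℕ),
        ((∃ p : ℕ, p.Prime ∧ sectionDensity Ψ i p = 1) ∨ singularProduct (Fin.removeNth i Ψ) = 0) →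
          (∀ m : ℕ, cell Ψ K N (slowDegree N) (i.insertNth m j') = 0) ∧
            sectionH Ψ i * (sectionMass Ψ K N (slowDegree N) i j' 1 : ℝ) = 0) ∧
  (∀ (t L : ℕ), ∃ N₀ : ℕ, ∀ N : ℕ, N₀ ≤ N →
      ∀ Ψ : Fin (t + 1) → AffLinForm 1, IsNondegenerateSystem Ψ → affLinSize Ψ N ≤ L →
      ∀ i : Fin (t + 1),
        (singularProduct (Fin.removeNth i Ψ) ≠ 0 →
            sectionH Ψ i = singularProduct Ψ / singularProduct (Fin.removeNth i Ψ)) ∧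
        (singularProduct (Fin.removeNth i Ψ) = 0 →
            ∀ (K : Set (Fin 1 → ℝ)) (j' : Fin t → ℕ), sectionMass Ψ K N (slowDegree N) i j' 1 = 0)) ∧
  (DensityBoundsAlong → ∀ t : ℕ, 1 ≤ t → LawSavAt t → ∀ (L : ℕ) (ε : ℝ), 0 < ε → ∃ N₀ : ℕ, ∀ N : ℕ, N₀ ≤ N →
      ∀ Ψ : Fin (t + 1) → AffLinForm 1, IsNondegenerateSystem Ψ → affLinSize Ψ N ≤ L →
      ∀ K : Set (Fin 1 → ℝ), Convex ℝ K → K ⊆ realBox 1 N →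
      ∀ i : Fin (t + 1), ∀ j' : Fin t → ℕ, (∀ k, 1 ≤ j' k ∧ j' k ≤ slowDegree N) →
        (sectionMass Ψ K N (slowDegree N) i j' 1 : ℝ) ≤ (N : ℝ) * Real.log N ^ ε / Real.log N ^ t)

/-- **The kernel hypotheses along the schedule, verified** (`HypAlong`; type of the registered stub `stub_hypAlong`):
the `secSeqB` identities, the two dimension bounds (`L' := max` of theirs) and the ATOM ALONG THE SCHEDULE (on the
convex bodies `K ∩ {ψ_i ≤ y}`, at roughness `u = U(N) ≤ U(N)`, level `N^{1-(log log N)^{-B₂}} ≥ x^{1-η}`, saving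
`(log N)^{-A}`) give `KernelReadySavAt t`; the nine range conditions hold for `N ≥ N₀` (port of `stub_geThreeHyp`:
`2L ≤ N^{1/U(N)}`, `8U(N) + 8 ≤ (log log N)^{B₂}`, `(2LN)^{1-1/(4U(N))} ≤ N/log^{t+2} N`, `U(N) ≤ √(log log N)`). -/
def HypAlong : Prop :=
  SectionSeqBFacts → SectionSeqBCells → SectionDimension → SectionDimensionLow →
    (∀ t : ℕ, 1 ≤ t → SectionLevelAlong t) → ∀ t : ℕ, 1 ≤ t → KernelReadySavAt t

/-- **The kernel application along the schedule** (`ReduceAlong`; type of the registered stub `stub_reduceAlong`):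
apply `SuperPolyRoughCellLaw a` at `(A₁ = t+2, L')` to the ready sequence at `u = U(N)`, with `B₂ := ⌈2/a⌉₊ + 1`
(so `a B₂ ≥ 2`) and `A := A₂ + t + 3`; for `N ≥ N₀` the four error terms are below
`V F/(log N)^δ + N/log^{t+2} N` with `δ = min(κ, 1)/4` (port of `stub_geThreeReduce`). -/
def ReduceAlong : Prop :=
  (∃ a : ℝ, 0 < a ∧ SuperPolyRoughCellLaw a) → (∀ t : ℕ, 1 ≤ t → KernelReadySavAt t) →
    ∀ t : ℕ, 1 ≤ t → RawSectionLawSavAt t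

/-- **Main-term conversion from the head bound** (`MainTermAlong`; type of the registered stub `stub_mainTermAlong`):
the sister's landed `SectionMertensLowerHead` (with the landed upper head bound `stub_sectionMertensHead` and Mertens'
product theorem with rate) gives the two-sided evaluation `|e^γ V(N^{1/U}) − U H/log N| ≤ C H U²/log² N` along the
schedule, and with Alladi along the schedule (`anatomyAlong_bridge`) the conversion `MainTermConversionAlong`
(port of `stub_sectionMertensTwo` + `stub_geThreeMainTerm`; `MainTermAux.core_bound` is reusable). -/
def MainTermAlong : Prop :=
  SectionMertensLowerHead → MainTermConversionAlong

/-- **The assembly along the schedule** (`AssemblyAlong`; type of the registered stub `stub_assemblyAlong`): the raw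
law on the localised body `K ∩ {ψ_i > x/Λ}`, the main-term conversion, the preparations (degenerate cases, Euler
ratio, fibre-mass bound from the sub-system law), the singular-series bookkeeping `H ≤ C_s (log log N)^D` and the
anatomy bounds `a_m ≤ (log N)^ε/log N` give Bombieri's one-parameter section law ALONG THE SCHEDULE with the
singular-series ratio `𝔖/𝔖₋ᵢ` (`SectionLawSavAt t`), for `t`-form sub-system laws granted. Port of
`stub_geThreeAssembly` with the quarter budget `Q = N/(8 log^{t+1} N (log N)^δ)`, `δ := δ_raw/4`, `ε := δ_raw/8`:
localisation `x/Λ + 1 ≤ 2Q`; raw error `V F' (log N)^{-δ_raw} ≤ (H (log N)^ε/log N)(N (log N)^ε/log^t N)(log N)^{-δ_raw} ≤ Q`;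
conversion `H F' (log N)^ε/log² N ≤ Q`; fibre-mass localisation inside the model `≤ 2Q`; small localised mass
`< N/log^{t+2} N`: every cell and the model are below the budget. -/
def AssemblyAlong : Prop :=
  SectionSeqBFacts → SectionSeqBCells → MainTermConversionAlong → PrepAlong → SingularRatioBound →
    DensityBoundsAlong → (∀ t : ℕ, 1 ≤ t → RawSectionLawSavAt t) →
      ∀ t : ℕ, 1 ≤ t → LawSavAt t → SectionLawSavAt t

/-! ## The engine from its pieces (pure logic) -/

/-- **`engineSav2_of_pieces`** (pure logic): the five glue stubs, fed with the sister's landed `u`-free inputs and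
this line's anatomy bounds, give `EngineSav2`. -/
theorem engineSav2_of_pieces (hF : SectionSeqBFacts) (hC : SectionSeqBCells) (hD : SectionDimension)
    (hDl : SectionDimensionLow) (hLH : SectionMertensLowerHead) (hSing : SingularRatioBound)
    (hDens : DensityBoundsAlong) (hHyp : HypAlong) (hRed : ReduceAlong) (hMT : MainTermAlong)
    (hPrep : PrepAlong) (hAsm : AssemblyAlong) : EngineSav2 :=
  fun hK hA t ht hLaw =>
    hAsm hF hC (hMT hLH) hPrep hSing hDens (hRed hK (hHyp hF hC hD hDl hA)) t ht hLaw

end Summit.Parity.GeneralizedHardyLittlewood.Cruxes.CellParityLawSaving.SuperPolyBand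

end
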